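import Summits.CriticalPhenomena.PercolationContinuityZ3.Theses.PercAxialLogConvexity
import Summits.CriticalPhenomena.PercolationContinuityZ3.Theorems.PercAxialLogConvexityBlockCrossoverStubAxialMass
import Summits.CriticalPhenomena.PercolationContinuityZ3.Theorems.PercAxialLogConvexityBlockCrossoverStubMassVanishes
import Literature.Probability.LatticeModels.CorrelationDecay

/-!
# Line `defconvex` — an ALTERNATIVE registered skeleton for the crux `BlockCrossover`
# (stmt-CriticalPhenomena-11550, route `PercAxialLogConvexity`, rank 3; strategist seat, 2026-08-17)

Crux (fixed, by name): `PercAxialLogConvexity.BlockCrossover`. The live line `birth`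
(`Lines/birth.lean`, lead c3) has ONE open stub, `stub_ratioCrossover` = the whole content: at the
scale `N = ⌈c/m⌉₊ = ⌈c ξ(p)⌉` pinned to the axial mass `m` of a cofinal `p ↑ p_c`, the block inequality
`e^{-c'/N} τ_p(n) τ_{p_c}(n+1) ≤ τ_p(n+1) τ_{p_c}(n)` on `N/2 ≤ n ≤ N` with `c' < c`
(`τ_q(i) := tau 3 q 0 (Pi.single 0 i)`, the axial two-point function of bond percolation on `ℤ³`).

THIS LINE factors that stub into SHAPE × SIZE of the *crossover deficit*
`D_p(i) := log τ_{p_c}(i) - log τ_p(i) ≥ 0` (non-negative by monotonicity in `p`). In logarithms the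
block inequality is the FIRST-ORDER statement `D_p(n+1) - D_p(n) ≤ c'/N` on `[N/2, N]`. We replace it by

* `stub_deficitConvex` (SHAPE, parameter-free sign condition): there is a window constant `c⋆ > 0`
  such that for all `0 < c_lo < c_hi ≤ c⋆`, for every `p < p_c` close enough to `p_c` (depending on
  `c_lo, c_hi`) with axial mass `m`, the deficit `j ↦ D_p(j)` is (discretely) CONVEX on the
  near-critical window `c_lo/m ≤ j`, `j + 2 ≤ c_hi/m`:
  `D_p(j+1) - D_p(j) ≤ D_p(j+2) - D_p(j+1)`. Scaling reading: `D_p(tξ) → 𝒟(t) ≍ t^{1/ν}` with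
  `1/ν = d_red ≈ 1.14 > 1` on `ℤ³` (Coniglio: the deficit's `p`-derivative is the conditional density
  of pivotal = red bonds, `∼ n^{1/ν}`), so `𝒟` is convex near `0`; in `d = 2` (`1/ν = 3/4`) it is
  concave and the lead's delimiter `blockCrossover_false_of_concaveDeficits` shows the crux then FAILS —
  this stub is exactly the complementary (convex) side. It is window-restricted on purpose: for
  `j ≫ ξ` Ornstein–Zernike (`τ_p ∼ n^{-(d-1)/2} e^{-mn}`, Campanino–Chayes–Chayes) against
  `τ_{p_c} ∼ n^{-(1+η)}` makes `D_p` eventually CONCAVE in `d = 3`, and below `c_lo ξ` lattice effects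
  are uncontrolled.
* `stub_windowComparability` (SIZE, zeroth order, one point): for every `c⋆ > 0` there are
  `0 < c ≤ c⋆` and `ρ < 1` such that cofinally in `p ↑ p_c`, `D_p(2⌈c/m⌉₊) ≤ ρ c`, i.e.
  `τ_p(2N) ≥ e^{-ρ c} τ_{p_c}(2N)` at `2N ≍ 2c ξ(p)`: the `ℤ³` two-point analogue of the
  Borgs–Chayes–Kesten–Spencer Scaling Axiom (III) (`π_n(p) ≍ π_n(p_c)` for `n ≤ L₀(p)`, a THEOREM in
  `d = 2` by Kesten 1987 / RSW) with a QUANTIFIED constant `e^{-ρc}`, `ρ c < c`, available for small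
  `c` in scaling theory because `𝒟(2c) ≍ (2c)^{1/ν} ≪ c` as `c → 0` (again `1/ν > 1`).
* Composition `ratioCrossover_of : DC → WC → (statement of stub_ratioCrossover)` PROVED below:
  take `c⋆` from DC, `(c, ρ)` from WC at `c⋆/4`, `c' := ρ c`; given `p₀`, thresholds `p₁` (DC at
  `(c_lo, c_hi) = (c/4, 4c)`) and `p₂` (`stub_massVanishes` at `ε = c/4`, LANDED), and the cofinal `p`
  of WC above `max p₀ p₁ p₂`; for its mass `m < c/4`, `N = ⌈c/m⌉₊ > 4`, convexity holds at every
  `j ∈ [n, 2N-2]` (`c/(4m) ≤ N/2 ≤ n`, `2N < 2c/m + 2 ≤ 4c/m`), so the increment at `n ∈ [N/2, N]` is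
  the smallest on `[n, 2N-1] ⊇ [N, 2N-1]`; summing, `N · (D_p(n+1) - D_p(n)) ≤ D_p(2N) - D_p(N) ≤ D_p(2N)
  ≤ ρ c`, i.e. `D_p(n+1) - D_p(n) ≤ c'/N`; exponentiate.
* `BlockCrossover_of : Stubs.stub_deficitConvex → Stubs.stub_windowComparability → BlockCrossover`
  (the route decl BY NAME), proved by the composition of line `birth` (copied here verbatim:
  `ε_k := c/(k+1)`, `p₀(ε_k)` from `stub_massVanishes`, cofinal `p_k`, `m_k` from `stub_axialMass`,
  `N_k := ⌈c/m_k⌉₊`, `C_k := 1`), and `BlockCrossover_proof := BlockCrossover_of stub_deficitConvex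
  stub_windowComparability`.

Why this dodges the STUCK goal of line `birth`: `stub_ratioCrossover` asks for a uniform bound on a
DERIVATIVE of the unknown crossover function at scale `ξ` — nothing to grab. Here the derivative
bound is manufactured from (i) a SIGN of a second difference (attackable through Russo's formula:
`∂_p D_p(n) = -(1/p) E_p[#pivotal bonds for 0 ↔ n e₁ ∣ 0 ↔ n e₁]`, so DC follows from convexity IN
DISTANCE of the conditional pivotal count below the correlation length — a statement about red bonds,
`d_red = 1/ν`), and (ii) a ONE-POINT, ZEROTH-ORDER comparability with an explicit constant (the kind
of statement finite-size-scaling / gluing arguments produce). Neither stub is the crux reworded: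
DC says nothing about sizes, WC alone bounds `D_p` at one point and cannot control where the
increments concentrate (WC alone only yields `τ_{p_c}(n_k e₁) ≤ e^{-(2-ρ)c} < 1` along a sequence,
far from `θ(p_c) = 0`).

Disproof.lean: none filed for this crux (2026-08-17). Delimiters honoured: `Delimiters.lean`
(`blockCrossover_false_of_concaveDeficits`) — this line sits on the convex side by construction;
refuter junk analysis (scales `N ≫ ξ`, `p = p_c`) — the scale stays pinned to `⌈c/m⌉₊` as in `birth`.
No new route, no restatement of the crux, lead's skeleton untouched.

References: Borgs–Chayes–Kesten–Spencer, CMP 224 (2001) (Scaling Axiom III; Chayes ICM 1998 §3);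
Kesten, CMP 109 (1987); Coniglio, PRL 46 (1981) / J. Phys. A 15 (1982) (`d_red = 1/ν`);
ben-Avraham–Havlin 2000 Table 2.2 (`d = 3`: `1/ν = 1.143`); Hutchcroft–Michta–Slade, arXiv:2107.12971
Thm 1.1 (high-`d` one-sided analogue); Campanino–Chayes–Chayes 1991 (OZ decay); Grimmett 1999 §6.2.
-/

noncomputable section

open MeasureTheory Filter Topology
open Literature.Probability.Percolation Literature.Probability.LatticeModels

namespace Summit.CriticalPhenomena.PercolationContinuityZ3.Cruxes.BlockCrossover.DefConvex

/-! ## The two registered stubs: precise `Prop`s `Stubs.stub_*` + sorried theorems `stub_*` -/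

namespace Stubs

/-- **Stub `Prop` 1 (`DeficitConvex`, OPEN; SHAPE)** — window convexity of the crossover deficit
`D_p(j) = log τ_{p_c}(0, j e₁) - log τ_p(0, j e₁)` on `c_lo ξ ≤ j ≤ c_hi ξ - 2` for `p` close to `p_c`,
for all `0 < c_lo < c_hi ≤ c⋆`. -/
def stub_deficitConvex : Prop :=
  ∃ cstar : ℝ, 0 < cstar ∧ ∀ clo chi : ℝ, 0 < clo → clo < chi → chi ≤ cstar →
    ∃ p₁ : unitInterval, p₁ < criticalProbI 3 ∧ ∀ p : unitInterval, p₁ < p → p < criticalProbI 3 →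
      ∀ m : ℝ, 0 < m → HasInvCorrLength (tau 3 p 0) m →
        ∀ j : ℕ, clo / m ≤ (j : ℝ) → (j : ℝ) + 2 ≤ chi / m →
          (Real.log (tau 3 (criticalProbI 3) 0 (Pi.single 0 ((j + 1 : ℕ) : ℤ))) -
                Real.log (tau 3 p 0 (Pi.single 0 ((j + 1 : ℕ) : ℤ)))) -
              (Real.log (tau 3 (criticalProbI 3) 0 (Pi.single 0 (j : ℤ))) -
                Real.log (tau 3 p 0 (Pi.single 0 (j : ℤ)))) ≤
            (Real.log (tau 3 (criticalProbI 3) 0 (Pi.single 0 ((j + 2 : ℕ) : ℤ))) -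
                Real.log (tau 3 p 0 (Pi.single 0 ((j + 2 : ℕ) : ℤ)))) -
              (Real.log (tau 3 (criticalProbI 3) 0 (Pi.single 0 ((j + 1 : ℕ) : ℤ))) -
                Real.log (tau 3 p 0 (Pi.single 0 ((j + 1 : ℕ) : ℤ))))

/-- **Stub `Prop` 2 (`WindowComparability`, OPEN; SIZE)** — one-point near-critical comparability
with a quantified constant: for every `c⋆ > 0` some `0 < c ≤ c⋆` and `ρ < 1` satisfy, cofinally in
`p ↑ p_c` (with `m` the axial mass of `p`), `D_p(2⌈c/m⌉₊) ≤ ρ c`, i.e.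
`τ_p(0, 2N e₁) ≥ e^{-ρc} τ_{p_c}(0, 2N e₁)` at `2N = 2⌈c ξ(p)⌉`. -/
def stub_windowComparability : Prop :=
  ∀ cstar : ℝ, 0 < cstar → ∃ c : ℝ, 0 < c ∧ c ≤ cstar ∧ ∃ ρ : ℝ, ρ < 1 ∧
    ∀ p₀ : unitInterval, p₀ < criticalProbI 3 →
      ∃ p : unitInterval, p₀ < p ∧ p < criticalProbI 3 ∧
        ∀ m : ℝ, 0 < m → HasInvCorrLength (tau 3 p 0) m →
          Real.log (tau 3 (criticalProbI 3) 0 (Pi.single 0 ((2 * ⌈c / m⌉₊ : ℕ) : ℤ))) -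
              Real.log (tau 3 p 0 (Pi.single 0 ((2 * ⌈c / m⌉₊ : ℕ) : ℤ))) ≤ ρ * c

end Stubs

/-- **stub 1 (registered) = `Stubs.stub_deficitConvex` spelled out (OPEN; SHAPE).**
Why plausibly true on `ℤ³`: `D_p(tξ) ≈ 𝒟(t) ≍ t^{1/ν}`, `1/ν = d_red ≈ 1.143 > 1` (Coniglio;
ben-Avraham–Havlin Table 2.2), convex near `0`; via Russo, `-p ∂_p D_p(n) = E_p[#pivotal ∣ 0 ↔ n e₁]`,
so it is the distance-convexity of the conditional red-bond count below `ξ`. Why it might fail: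
corrections to scaling at finite `ξ` are uncontrolled; the sign is wrong for `j ≫ ξ` (OZ) — hence the
window `c_hi ≤ c⋆` and the threshold `p₁(c_lo, c_hi)`. Size: open (no near-critical two-point shape
control on `ℤ³` exists: Grimmett 1999 §6.2; arXiv:2107.12971 Thm 1.1 is one-sided and `d > 6`). -/
theorem stub_deficitConvex :
    ∃ cstar : ℝ, 0 < cstar ∧ ∀ clo chi : ℝ, 0 < clo → clo < chi → chi ≤ cstar →
      ∃ p₁ : unitInterval, p₁ < criticalProbI 3 ∧ ∀ p : unitInterval, p₁ < p → p < criticalProbI 3 →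
        ∀ m : ℝ, 0 < m → HasInvCorrLength (tau 3 p 0) m →
          ∀ j : ℕ, clo / m ≤ (j : ℝ) → (j : ℝ) + 2 ≤ chi / m →
            (Real.log (tau 3 (criticalProbI 3) 0 (Pi.single 0 ((j + 1 : ℕ) : ℤ))) -
                  Real.log (tau 3 p 0 (Pi.single 0 ((j + 1 : ℕ) : ℤ)))) -
                (Real.log (tau 3 (criticalProbI 3) 0 (Pi.single 0 (j : ℤ))) -
                  Real.log (tau 3 p 0 (Pi.single 0 (j : ℤ)))) ≤
              (Real.log (tau 3 (criticalProbI 3) 0 (Pi.single 0 ((j + 2 : ℕ) : ℤ))) -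
                  Real.log (tau 3 p 0 (Pi.single 0 ((j + 2 : ℕ) : ℤ)))) -
                (Real.log (tau 3 (criticalProbI 3) 0 (Pi.single 0 ((j + 1 : ℕ) : ℤ))) -
                  Real.log (tau 3 p 0 (Pi.single 0 ((j + 1 : ℕ) : ℤ)))) := by
  sorry

/-- **stub 2 (registered) = `Stubs.stub_windowComparability` spelled out (OPEN; SIZE).**
Why plausibly true on `ℤ³`: `D_p(2cξ) ≈ 𝒟(2c) ≍ (2c)^{1/ν} ≤ ρ c` for small `c` since `1/ν > 1`;
it is the two-point, quantified form of the BCKS Scaling Axiom (III) (`π_n(p) ≍ π_n(p_c)`,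
`n ≤ L₀(p)`; proved in `d = 2`, Kesten 1987). Why it might fail: the constant must beat `e^{-c}`
(`ρ < 1`), not merely exist; no finite-size-scaling comparability is proved on `ℤ³`. Size: open. -/
theorem stub_windowComparability :
    ∀ cstar : ℝ, 0 < cstar → ∃ c : ℝ, 0 < c ∧ c ≤ cstar ∧ ∃ ρ : ℝ, ρ < 1 ∧
      ∀ p₀ : unitInterval, p₀ < criticalProbI 3 →
        ∃ p : unitInterval, p₀ < p ∧ p < criticalProbI 3 ∧
          ∀ m : ℝ, 0 < m → HasInvCorrLength (tau 3 p 0) m →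
            Real.log (tau 3 (criticalProbI 3) 0 (Pi.single 0 ((2 * ⌈c / m⌉₊ : ℕ) : ℤ))) -
                Real.log (tau 3 p 0 (Pi.single 0 ((2 * ⌈c / m⌉₊ : ℕ) : ℤ))) ≤ ρ * c := by
  sorry

/-! ## Elementary lemmas: discrete convexity ⇒ monotone increments ⇒ block sums -/

/-- Discrete convexity on `[n, M]` makes the increment at `n` the smallest on `[n, M-1]`. -/
theorem incr_mono_of_convex (D : ℕ → ℝ) (n M : ℕ)
    (hconv : ∀ j : ℕ, n ≤ j → j + 2 ≤ M → D (j + 1) - D j ≤ D (j + 2) - D (j + 1)) :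
    ∀ j : ℕ, n ≤ j → j + 1 ≤ M → D (n + 1) - D n ≤ D (j + 1) - D j := by
  intro j
  induction j with
  | zero =>
    intro hn _
    obtain rfl : n = 0 := Nat.le_zero.1 hn
    exact le_rfl
  | succ j ih =>
    intro hnj hjM
    rcases Nat.eq_or_lt_of_le hnj with h | h
    · subst h
      exact le_rfl
    · have hnj' : n ≤ j := Nat.lt_succ_iff.1 h
      have h1 := ih hnj' (by omega)
      have h2 := hconv j hnj' (by omega)
      have e : j + 1 + 1 = j + 2 := rfl
      rw [e]
      exact h1.trans h2

/-- If every increment on `[N, N+k-1]` is at least `a`, then `k · a ≤ D(N+k) - D(N)`. -/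
theorem mul_le_sub_of_le_incr (D : ℕ → ℝ) (a : ℝ) (N : ℕ) :
    ∀ k : ℕ, (∀ j : ℕ, N ≤ j → j + 1 ≤ N + k → a ≤ D (j + 1) - D j) →
      (k : ℝ) * a ≤ D (N + k) - D N := by
  intro k
  induction k with
  | zero => intro _; simp
  | succ k ih =>
    intro h
    have h1 : (k : ℝ) * a ≤ D (N + k) - D N := ih fun j hj hj' => h j hj (by omega)
    have h2 : a ≤ D (N + k + 1) - D (N + k) := h (N + k) (by omega) (by omega)
    have e : N + (k + 1) = N + k + 1 := rfl
    rw [e]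
    push_cast
    linarith

/-! ## Notation-level helpers for the axial two-point function and the deficit -/

/-- The axial two-point function `τ_q(0, i e₁)` of bond percolation on `ℤ³`. -/
def tauAx (q : unitInterval) (i : ℕ) : ℝ := tau 3 q 0 (Pi.single 0 (i : ℤ))

/-- The crossover deficit `D_p(i) = log τ_{p_c}(0, i e₁) - log τ_p(0, i e₁)`. -/
def deficit (p : unitInterval) (i : ℕ) : ℝ :=
  Real.log (tauAx (criticalProbI 3) i) - Real.log (tauAx p i)

theorem criticalProbI_three_pos : 0 < ((criticalProbI 3 : unitInterval) : ℝ) := by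
  rw [coe_criticalProbI]; exact_mod_cast criticalProb_zd_pos 3 (by norm_num)

theorem tauAx_pos (q : unitInterval) (hq : 0 < (q : ℝ)) (i : ℕ) : 0 < tauAx q i :=
  Summit.CriticalPhenomena.PercolationContinuityZ3.Theorems.BlockCrossover.StubAxialMass.tau_axial_pos
    (d := 3) q hq i

/-- Monotonicity in `p`: `τ_q(0, i e₁) ≤ τ_{p_c}(0, i e₁)` for `q ≤ p_c`. -/
theorem tauAx_le_crit (q : unitInterval) (hqc : q ≤ criticalProbI 3) (i : ℕ) :
    tauAx q i ≤ tauAx (criticalProbI 3) i :=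
  DCT16.real_mono_of_isUpperSet (zdGraph 3) (isUpperSet_openConn _ _)
    (measurableSet_openConn_holds _ _) hqc

/-- The deficit is non-negative for `0 < p ≤ p_c`. -/
theorem deficit_nonneg (p : unitInterval) (hp : 0 < (p : ℝ)) (hpc : p ≤ criticalProbI 3) (i : ℕ) :
    0 ≤ deficit p i := by
  have := Real.log_le_log (tauAx_pos p hp i) (tauAx_le_crit p hpc i)
  unfold deficit
  linarith

/-! ## The composition, part 1 (proved): DC → WC → the statement of `birth`'s `stub_ratioCrossover` -/

/-- **SHAPE × SIZE ⇒ the ratio crossover** (the exact statement of the live line's open stub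
`Birth.stub_ratioCrossover`, obtained from the two stubs of this line; no `sorry`). -/
theorem ratioCrossover_of (hDC : Stubs.stub_deficitConvex) (hWC : Stubs.stub_windowComparability) :
    ∃ c c' : ℝ, 0 < c ∧ c' < c ∧ ∀ p₀ : unitInterval, p₀ < criticalProbI 3 →
      ∃ p : unitInterval, p₀ < p ∧ p < criticalProbI 3 ∧
        ∀ m : ℝ, 0 < m → HasInvCorrLength (tau 3 p 0) m →
          ∀ n : ℕ, ((⌈c / m⌉₊ : ℕ) : ℝ) ≤ 2 * n → n ≤ ⌈c / m⌉₊ →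
            Real.exp (-(c' / (⌈c / m⌉₊ : ℕ))) *
                (tau 3 p 0 (Pi.single 0 (n : ℤ)) *
                  tau 3 (criticalProbI 3) 0 (Pi.single 0 ((n + 1 : ℕ) : ℤ))) ≤
              tau 3 p 0 (Pi.single 0 ((n + 1 : ℕ) : ℤ)) *
                tau 3 (criticalProbI 3) 0 (Pi.single 0 (n : ℤ)) := by
  classical
  obtain ⟨cstar, hcstar, HDC⟩ := hDC
  obtain ⟨c, hc, hcle, ρ, hρ, HWC⟩ := hWC (cstar / 4) (by positivity)
  refine ⟨c, ρ * c, hc, ?_, ?_⟩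
  · calc ρ * c < 1 * c := mul_lt_mul_of_pos_right hρ hc
      _ = c := one_mul c
  intro p₀ hp₀
  -- threshold of DC at the window (c/4, 4c) ⊆ (0, c⋆]
  obtain ⟨p₁, hp₁, HDC1⟩ := HDC (c / 4) (4 * c) (by positivity) (by linarith) (by linarith)
  -- threshold of the LANDED `stub_massVanishes` at ε = c/4
  obtain ⟨p₂, hp₂, HMV⟩ :=
    Summit.CriticalPhenomena.PercolationContinuityZ3.Theorems.BlockCrossover.stub_massVanishes
      (c / 4) (by positivity)
  -- the cofinal point of WC above all three thresholds
  have hP : max p₀ (max p₁ p₂) < criticalProbI 3 := max_lt hp₀ (max_lt hp₁ hp₂)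
  obtain ⟨p, hPp, hppc, HWCp⟩ := HWC (max p₀ (max p₁ p₂)) hP
  have hp₀p : p₀ < p := lt_of_le_of_lt (le_max_left _ _) hPp
  have hp₁p : p₁ < p := lt_of_le_of_lt ((le_max_left _ _).trans (le_max_right _ _)) hPp
  have hp₂p : p₂ < p := lt_of_le_of_lt ((le_max_right _ _).trans (le_max_right _ _)) hPp
  have hppos : 0 < (p : ℝ) :=
    lt_of_le_of_lt (unitInterval.nonneg p₀) (Subtype.coe_lt_coe.2 hp₀p)
  refine ⟨p, hp₀p, hppc, ?_⟩
  intro m hm hmicl n hNn hnN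
  set N : ℕ := ⌈c / m⌉₊ with hN
  -- the scale: c/m ≤ N < c/m + 1 and c/m > 4
  have hmlt : m < c / 4 := HMV p hp₂p hppc m hmicl
  have hcm_le : c / m ≤ (N : ℝ) := Nat.le_ceil _
  have hcm_lt : (N : ℝ) < c / m + 1 := Nat.ceil_lt_add_one (by positivity)
  have h4 : 4 < c / m := by rw [lt_div_iff₀ hm]; linarith
  have hNpos : (0 : ℝ) < N := by linarith
  have hn0 : (0 : ℝ) ≤ n := Nat.cast_nonneg n
  -- DC on the window n ≤ j, j + 2 ≤ 2N (inside [c/(4m), 4c/m])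
  have hconv : ∀ j : ℕ, n ≤ j → j + 2 ≤ 2 * N →
      deficit p (j + 1) - deficit p j ≤ deficit p (j + 2) - deficit p (j + 1) := by
    intro j hnj hj2
    have hlo : c / 4 / m ≤ (j : ℝ) := by
      have hnj' : (n : ℝ) ≤ j := by exact_mod_cast hnj
      have e : c / 4 / m = (c / m) / 4 := by ring
      rw [e]
      linarith
    have hhi : (j : ℝ) + 2 ≤ 4 * c / m := by
      have hj2' : (j : ℝ) + 2 ≤ 2 * (N : ℝ) := by exact_mod_cast hj2
      have e : 4 * c / m = 4 * (c / m) := by ring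
      rw [e]
      linarith
    exact HDC1 p hp₁p hppc m hm hmicl j hlo hhi
  -- the increment at n is the smallest on [n, 2N-1] ⊇ [N, 2N-1]; sum over the top block
  have hchain := incr_mono_of_convex (deficit p) n (2 * N) hconv
  have hsum : (N : ℝ) * (deficit p (n + 1) - deficit p n) ≤ deficit p (N + N) - deficit p N :=
    mul_le_sub_of_le_incr (deficit p) _ N N fun j hj hj' => hchain j (hnN.trans hj) (by omega)
  have h2N : N + N = 2 * N := (two_mul N).symm
  rw [h2N] at hsum
  -- SIZE: D_p(N) ≥ 0 and D_p(2N) ≤ ρ c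
  have hDN : 0 ≤ deficit p N := deficit_nonneg p hppos hppc.le N
  have hWC' : deficit p (2 * N) ≤ ρ * c := by
    rw [hN]
    exact HWCp m hm hmicl
  have hincr : deficit p (n + 1) - deficit p n ≤ ρ * c / N := by
    rw [le_div_iff₀ hNpos]
    calc (deficit p (n + 1) - deficit p n) * N = (N : ℝ) * (deficit p (n + 1) - deficit p n) := by
          ring
      _ ≤ deficit p (2 * N) - deficit p N := hsum
      _ ≤ ρ * c := by linarith
  -- back to the multiplicative block inequality
  have ha := tauAx_pos p hppos n
  have ha1 := tauAx_pos p hppos (n + 1)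
  have hb := tauAx_pos (criticalProbI 3) criticalProbI_three_pos n
  have hb1 := tauAx_pos (criticalProbI 3) criticalProbI_three_pos (n + 1)
  have hincr' : -(ρ * c / N) + Real.log (tauAx p n) + Real.log (tauAx (criticalProbI 3) (n + 1)) ≤
      Real.log (tauAx p (n + 1)) + Real.log (tauAx (criticalProbI 3) n) := by
    unfold deficit at hincr
    linarith
  show Real.exp (-(ρ * c / N)) * (tauAx p n * tauAx (criticalProbI 3) (n + 1)) ≤
    tauAx p (n + 1) * tauAx (criticalProbI 3) n
  calc Real.exp (-(ρ * c / N)) * (tauAx p n * tauAx (criticalProbI 3) (n + 1))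
        = Real.exp (-(ρ * c / N) + Real.log (tauAx p n) +
            Real.log (tauAx (criticalProbI 3) (n + 1))) := by
          rw [Real.exp_add, Real.exp_add, Real.exp_log ha, Real.exp_log hb1]
          ring
    _ ≤ Real.exp (Real.log (tauAx p (n + 1)) + Real.log (tauAx (criticalProbI 3) n)) :=
          Real.exp_le_exp.2 hincr'
    _ = tauAx p (n + 1) * tauAx (criticalProbI 3) n := by
          rw [Real.exp_add, Real.exp_log ha1, Real.exp_log hb]

/-! ## The composition, part 2 (proved): the two stubs imply the crux BY NAME -/

/-- **`BlockCrossover` from the two stubs of line `defconvex`** (hypotheses = the declared stub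
`Prop`s by name; the landed `stub_axialMass`, `stub_massVanishes` used inside; conclusion = the route
decl `PercAxialLogConvexity.BlockCrossover` by name; no `sorry`). Witnesses as in line `birth`:
`c, c'` from `ratioCrossover_of`; `p_k` its cofinal point above `p₀(c/(k+1))` of `stub_massVanishes`;
`N_k := ⌈c/m_k⌉₊` with `m_k` the mass of `p_k`; `C_k := 1`. -/
theorem BlockCrossover_of (hDC : Stubs.stub_deficitConvex) (hWC : Stubs.stub_windowComparability) :
    Summit.CriticalPhenomena.PercolationContinuityZ3.Theses.PercAxialLogConvexity.BlockCrossover := by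
  classical
  have h1 :=
    Summit.CriticalPhenomena.PercolationContinuityZ3.Theorems.BlockCrossover.stub_axialMass
  have h2 :=
    Summit.CriticalPhenomena.PercolationContinuityZ3.Theorems.BlockCrossover.stub_massVanishes
  obtain ⟨c, c', hc, hcc', H⟩ := ratioCrossover_of hDC hWC
  -- massVanishes at the tolerances ε_k := c / (k + 1)
  have h2' : ∀ k : ℕ, ∃ p₀ : unitInterval, p₀ < criticalProbI 3 ∧
      ∀ p : unitInterval, p₀ < p → p < criticalProbI 3 →
        ∀ m : ℝ, HasInvCorrLength (tau 3 p 0) m → m < c / ((k : ℝ) + 1) :=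
    fun k => h2 (c / ((k : ℝ) + 1)) (div_pos hc (Nat.cast_add_one_pos k))
  choose p₀ hp₀ hp₀m using h2'
  -- the cofinal points above each p₀ k
  choose p hp₁ hp₂ hblk using fun k => H (p₀ k) (hp₀ k)
  have hppos : ∀ k, 0 < (p k : ℝ) := fun k =>
    lt_of_le_of_lt (unitInterval.nonneg (p₀ k)) (Subtype.coe_lt_coe.2 (hp₁ k))
  -- masses and sharp bounds at the points p k
  choose m hm hmicl hbd using fun k => h1 (p k) (hppos k) (hp₂ k)
  have hmlt : ∀ k, m k < c / ((k : ℝ) + 1) := fun k =>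
    hp₀m k (p k) (hp₁ k) (hp₂ k) (m k) (hmicl k)
  refine ⟨c, c', hcc', p, fun k => ⌈c / m k⌉₊, fun _ => 1, ?_, ?_, ?_, ?_⟩
  · -- 0 < p_k ≤ p_c
    intro k
    exact ⟨hppos k, (hp₂ k).le⟩
  · -- the scales are unbounded: N_M ≥ c / m_M > M + 1
    intro M
    refine ⟨M, ?_⟩
    show M ≤ ⌈c / m M⌉₊
    have hMlt : (M : ℝ) + 1 < c / m M := by
      rw [lt_div_iff₀ (hm M)]
      have h' := (lt_div_iff₀ (Nat.cast_add_one_pos M)).1 (hmlt M)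
      linarith
    have hceil : c / m M ≤ ((⌈c / m M⌉₊ : ℕ) : ℝ) := Nat.le_ceil _
    have : (M : ℝ) ≤ ((⌈c / m M⌉₊ : ℕ) : ℝ) := by linarith
    exact_mod_cast this
  · -- clause (a): e^{-m_k n} ≤ 1 · e^{-(c/N_k) n} since c / N_k ≤ m_k
    intro k n
    show tau 3 (p k) 0 (Pi.single 0 (n : ℤ)) ≤
      1 * Real.exp (-(c / ((⌈c / m k⌉₊ : ℕ) : ℝ)) * n)
    have hNpos : (0 : ℝ) < ((⌈c / m k⌉₊ : ℕ) : ℝ) := by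
      have : 0 < ⌈c / m k⌉₊ := Nat.ceil_pos.2 (div_pos hc (hm k))
      exact_mod_cast this
    have hrate : c / ((⌈c / m k⌉₊ : ℕ) : ℝ) ≤ m k := by
      rw [div_le_iff₀ hNpos]
      have h0 : c / m k ≤ ((⌈c / m k⌉₊ : ℕ) : ℝ) := Nat.le_ceil _
      rw [div_le_iff₀ (hm k)] at h0
      linarith
    have hn : (0 : ℝ) ≤ n := n.cast_nonneg
    have hmono : -(m k) * n ≤ -(c / ((⌈c / m k⌉₊ : ℕ) : ℝ)) * n := by
      have := mul_le_mul_of_nonneg_right hrate hn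
      linarith
    calc tau 3 (p k) 0 (Pi.single 0 (n : ℤ)) ≤ Real.exp (-(m k) * n) := hbd k n
      _ ≤ Real.exp (-(c / ((⌈c / m k⌉₊ : ℕ) : ℝ)) * n) := Real.exp_le_exp.2 hmono
      _ = 1 * Real.exp (-(c / ((⌈c / m k⌉₊ : ℕ) : ℝ)) * n) := (one_mul _).symm
  · -- clause (b): the ratio crossover verbatim at N_k = ⌈c / m_k⌉₊
    intro k n hNn hnN
    exact hblk k (m k) (hm k) (hmicl k) n hNn hnN

/-- **The skeleton IS the crux proof** (D-0027 §3.3): `BlockCrossover` from the two registered stubs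
of line `defconvex`; sorry-free as soon as `stub_deficitConvex` and `stub_windowComparability` are
discharged. -/
theorem BlockCrossover_proof :
    Summit.CriticalPhenomena.PercolationContinuityZ3.Theses.PercAxialLogConvexity.BlockCrossover :=
  BlockCrossover_of stub_deficitConvex stub_windowComparability

end Summit.CriticalPhenomena.PercolationContinuityZ3.Cruxes.BlockCrossover.DefConvex

end
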